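import Summits.QuantumFields.YangMills.Theorems.BalabanUVNodesN15KingModelContinuumSymbol
import Literature.MathematicalPhysics.QuantumFieldTheory.King1986.CovarianceRateTorus

/-!
# BalabanUVNodes ∕ N15 — THE KING-MODEL RUNG (PART Ϡ-h): KING's LEMMA 4.3 (4.18) AGAINST THE LIMIT — `|Δ^{(K)}(p′) − Δ^{(∞)}(p′)| ≤ C(a)·L^{−2K}` UNIFORMLY IN
# `d`, `m²`, THE TORUS AND THE MOMENTUM; THE ZERO MODE `S_∞(0) = 1∕m²`, `Δ^{(∞)}(0) = (a_∞⁻¹ + 1∕m²)⁻¹`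
# (Track A, DAG node N15 = NE2; FAN-OUT v1.1 §N15 s3 «KING-MODEL RUNG … NE2's analogue DECIDED in the model»)

HONEST FRAMING.  Count-neutral (cell `pub-ymgap`, seat `pub-ymgap-dag-n15-e` g32; `--supports stmt-QuantumFields-27366 --as helper` = K3⁸
`SpineGivenEndpointR13SepCoPHV`).  TEMPLATE LITERATURE: C. King, *The U(1) Higgs model. I. The continuum limit*, Commun. Math. Phys. **102** (1986) 649–677
[King1986] — KING's OWN `A = 0` MODEL: Lemma 4.3 (4.18) p. 672 «|Δ^{(k)}(p) − Δ^{(k+n)}(p)| ≦ CL^{−2k}|Δ^{(k)}(p)|» (tree `King1986.lemma43_aK`, explicit constant,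
`p′ ≠ 0`), the zero mode of (4.5) (`King1986.Torus.DeltaEff_zero`: `Δ^{(k)}(0) = (a_k⁻¹ + (m²)⁻¹)⁻¹`), (2.13) `a_k`, and part Ϡ-c's limit symbol `Δ^{(∞)} = effSymLim`.
NOT Bałaban's objects; NOT a node discharge (N15 is booked through n15-a's knit, untouched here); nothing continuum-Yang–Mills ∕ ℝ⁴ ∕ OS ∕ mass-gap ∕ Clay.
0 `sorry`; standard axioms; 0 `def`.

THE MATHEMATICS.  Part Ϡ-c proved `Δ^{(K)}(p′(q)) → Δ^{(∞)}(p′(q))` (Tannery, no rate).  For `p′ ≠ 0` Lemma 4.3 at `n = 1` gives the geometric steps `|Δ^{(K)} − Δ^{(K+1)}|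
≤ 2a_K(a⁻¹ + π²∕48 + 1∕3)L^{−2K}Δ^{(K)} ≤ 2a²(a⁻¹ + π²∕48 + 1∕3)·(L²)^{−K}` (`a_K, Δ^{(K)} ≤ a`), so Mathlib's `dist_le_of_le_geometric_of_tendsto` (on the shifted
sequence, ratio `L^{−2}`) bounds the distance to the identified limit by `2a²(a⁻¹ + π²∕48 + 1∕3)·L²∕(L²−1)·L^{−2K} ≤ (8∕3)a²(…)L^{−2K}` (§2).  At `p′ = 0` both symbols
are explicit: `S_∞(0) = 1∕m²` (only `j = 0` survives: `u⁰(2πj) = 0` for `j ≠ 0`, §1), `Δ^{(K)}(0) = (a_K⁻¹ + 1∕m²)⁻¹`, `Δ^{(∞)}(0) = (a_∞⁻¹ + 1∕m²)⁻¹`, and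
`x ↦ (x⁻¹ + c)⁻¹` is `1`-Lipschitz on `x > 0` (`c ≥ 0`), `a_K − a_∞ = a_∞L^{−2K}∕(1 − L^{−2K}) ≤ (4∕3)a·L^{−2K}`; so ONE constant `C(a) = (8∕3)(a + a²(π²∕48 + 1∕3)) + (4∕3)a`
serves every torus momentum (§3): Lemma 4.3 with `n = ∞`.

WHAT THIS FILE PROVES (kernel).  §1 `uFac0_two_pi_mul_int` (`f₀(2πk) = 0`, `k ≠ 0`), `aliasTerm0_zero_mom` , ★ **`aliasSeries0_zero`** (`S_∞(0) = 1∕m²`), ★ `effSymLim_zero`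
(`Δ^{(∞)}(0) = (a_∞⁻¹ + (m²)⁻¹)⁻¹`).  §2 `DeltaEff_le_a`, ★ `abs_DeltaEff_succ_sub_le` (the geometric step, `p′ ≠ 0`), ★★★ **`abs_DeltaEff_sub_lim_le_of_ne_zero`**
(`|Δ^{(K)}(p′(q)) − Δ^{(∞)}(p′(q))| ≤ (8∕3)a²(a⁻¹ + π²∕48 + 1∕3)·L^{−2K}`, `q ≠ 0`, `K ≥ 1`).  §3 `aK_sub_aInf_le` (`0 ≤ a_K − a_∞ ≤ (4∕3)a L^{−2K}`), `abs_invAddInv_sub_le`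
(the Lipschitz letter), ★★ `abs_DeltaEff_sub_lim_le_zero`, ★★★ **`abs_DeltaEff_sub_lim_le`** (ALL momenta of every unit torus, one constant `kingSymbolRateConst a`·`L^{−2K}`).

HONEST SCOPE.  King's `A = 0` model; odd `L ≥ 2`, `a, m² > 0`; torus momenta `p′ = sOf q`; constants explicit, not optimised.  N15 untouched; counts unmoved.
Locators: [King1986] (2.13) p.653, (4.3)–(4.5) p.670, Lemma 4.3 (4.18) p.672, Prop. 3.10 (3.91)–(3.93) p.669.
-/

noncomputable section

open Complex Finset Filter Topology

namespace Summit.QuantumFields.YangMills.BalabanUVNodes.N15KingModelRung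

open Literature.MathematicalPhysics.QuantumFieldTheory.Balaban1983to89.B5Prop11Plancherel (Tor fine sOf abs_sOf_le sOf_zero sOf_ne_zero)
open Literature.MathematicalPhysics.QuantumFieldTheory.King1986
open Literature.MathematicalPhysics.QuantumFieldTheory.King1986.Torus

variable {d : ℕ}

/-! ## §1 The zero mode of the continuum alias series and of `Δ^{(∞)}` -/

section ZeroMode

/-- `f₀(2πk) = 0` for a nonzero integer `k` (`e^{−2πik} = 1`). [cite: King1986, (4.3) p.670] -/
theorem uFac0_two_pi_mul_int {k : ℤ} (hk : k ≠ 0) : uFac0 (2 * Real.pi * k) = 0 := by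
  have hx : (2 * Real.pi * k : ℝ) ≠ 0 := mul_ne_zero (mul_ne_zero two_ne_zero Real.pi_ne_zero) (Int.cast_ne_zero.mpr hk)
  unfold uFac0
  rw [if_neg hx, div_eq_zero_iff]
  left
  rw [sub_eq_zero]
  have h : I * ((-(2 * Real.pi * (k : ℝ)) : ℝ) : ℂ) = ((-k : ℤ) : ℂ) * (2 * Real.pi * I) := by push_cast; ring
  rw [h, Complex.exp_int_mul_two_pi_mul_I]

/-- At `p′ = 0` the alias terms are `[j = 0]∕m²`. [cite: King1986, (4.3)–(4.5) p.670] -/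
theorem aliasTerm0_zero_mom (M : ℝ) (j : Fin d → ℤ) : aliasTerm0 M (0 : Fin d → ℝ) j = if j = 0 then M⁻¹ else 0 := by
  unfold aliasTerm0
  split_ifs with hj
  · subst hj
    have hpt : aliasPt (0 : Fin d → ℝ) (0 : Fin d → ℤ) = 0 := by
      funext μ; simp [aliasPt]
    rw [hpt]
    have hu : uWeight0 (0 : Fin d → ℝ) = 1 := by
      unfold uWeight0
      exact Finset.prod_eq_one fun μ _ => by simp [uFac0]
    rw [hu, norm_one, one_pow]
    simp [momSq]
  · obtain ⟨μ, hμ⟩ : ∃ μ, j μ ≠ 0 := Function.ne_iff.mp hj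
    have hzero : uWeight0 (aliasPt (0 : Fin d → ℝ) j) = 0 := by
      unfold uWeight0
      exact Finset.prod_eq_zero (Finset.mem_univ μ) (by
        have : aliasPt (0 : Fin d → ℝ) j μ = 2 * Real.pi * (j μ : ℝ) := by simp [aliasPt]
        rw [this]
        exact uFac0_two_pi_mul_int hμ)
    rw [hzero, norm_zero, zero_pow two_ne_zero, zero_div]

/-- ★ **THE ZERO MODE OF THE CONTINUUM ALIAS SERIES**: `S_∞(0) = 1∕m²` (only the un-aliased term survives). [cite: King1986, (4.5) p.670] -/
theorem aliasSeries0_zero (M : ℝ) : aliasSeries0 M (0 : Fin d → ℝ) = M⁻¹ := by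
  unfold aliasSeries0
  simp_rw [aliasTerm0_zero_mom]
  rw [tsum_ite_eq]

/-- ★ `Δ^{(∞)}(0) = (a_∞⁻¹ + (m²)⁻¹)⁻¹` (`a > 0`, `L > 1`, `m² > 0`) — the limit of the tree's `DeltaEff_zero`. [cite: King1986, (4.5) p.670, (2.13) p.653] -/
theorem effSymLim_zero {a Lr M : ℝ} (ha : 0 < a) (hL : 1 < Lr) (hM : 0 < M) : effSymLim a Lr M (0 : Fin d → ℝ) = ((aInf a Lr)⁻¹ + M⁻¹)⁻¹ := by
  rw [effSymLim_eq_inv ha hL hM.le, aliasSeries0_zero]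

end ZeroMode

/-! ## §2 The rate at nonzero momenta: Lemma 4.3 summed to the limit -/

section RateNonzero

variable (L : ℕ) (Mv : Fin d → ℕ) [hMv : ∀ μ, NeZero (Mv μ)]

omit hMv in
/-- `Δ^{(K)}(p′) ≤ a` (`Δ^{(K)} ≤ a_K ≤ a`). [cite: King1986, (4.5) p.670, (2.13) p.653] -/
theorem DeltaEff_le_a (hL : 2 ≤ L) {a m2 : ℝ} (ha : 0 < a) (hm : 0 < m2) {K : ℕ} (hK : 1 ≤ K) (p : Fin d → ℝ) :
    DeltaEff (aK a L K) (L ^ K) m2 p ≤ a := by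
  have hL1 : (1 : ℝ) < L := by exact_mod_cast (show 1 < L by omega)
  exact (DeltaEff_le (aK_pos ha hL1 hK) (L ^ K) hm.le p).trans (aK_le ha hL1 hK)

omit hMv in
/-- ★ THE GEOMETRIC STEP (Lemma 4.3 at `n = 1`, absolute form): for `p′ ≠ 0` in `[−π, π]^d`, `K ≥ 1`,
`|Δ^{(K)}(p′) − Δ^{(K+1)}(p′)| ≤ 2a²(a⁻¹ + π²∕48 + 1∕3)·(L²)^{−K}`. [cite: King1986, Lemma 4.3 (4.18) p.672] -/
theorem abs_DeltaEff_succ_sub_le (hL : 2 ≤ L) {a m2 : ℝ} (ha : 0 < a) (hm : 0 < m2) {K : ℕ} (hK : 1 ≤ K) {p : Fin d → ℝ}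
    (hp : ∀ μ, |p μ| ≤ Real.pi) (hp0 : 0 < momSq p) :
    |DeltaEff (aK a L K) (L ^ K) m2 p - DeltaEff (aK a L (K + 1)) (L ^ (K + 1)) m2 p|
      ≤ 2 * a ^ 2 * (a⁻¹ + Real.pi ^ 2 / 48 + 1 / 3) * (((L : ℝ) ^ 2)⁻¹) ^ K := by
  have hL1 : (1 : ℝ) < L := by exact_mod_cast (show 1 < L by omega)
  have h := lemma43_aK (dd := d) ha hL hK le_rfl hm.le hp hp0
  rw [aK_one hL1, show L ^ 1 * L ^ K = L ^ (K + 1) by ring] at h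
  have haK : 0 < aK a (L : ℝ) K := aK_pos ha hL1 hK
  have haKle : aK a (L : ℝ) K ≤ a := aK_le ha hL1 hK
  have hΔ0 : 0 ≤ DeltaEff (aK a L K) (L ^ K) m2 p := (DeltaEff_pos haK (Nat.one_le_pow K L (by omega)) hm.le hp hp0).le
  have hΔ : DeltaEff (aK a L K) (L ^ K) m2 p ≤ a := DeltaEff_le_a L hL ha hm hK p
  have hc0 : 0 ≤ a⁻¹ + Real.pi ^ 2 / 48 + 1 / 3 := by positivity
  have hpow : (((L ^ K : ℕ) : ℝ) ^ 2)⁻¹ = (((L : ℝ) ^ 2)⁻¹) ^ K := by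
    push_cast
    rw [← pow_mul, mul_comm, pow_mul, inv_pow]
  rw [hpow] at h
  have hr0 : 0 ≤ (((L : ℝ) ^ 2)⁻¹) ^ K := by positivity
  calc _ ≤ aK a L K * (2 * ((a⁻¹ + Real.pi ^ 2 / 48 + 1 / 3) * (((L : ℝ) ^ 2)⁻¹) ^ K)) * DeltaEff (aK a L K) (L ^ K) m2 p := h
    _ ≤ a * (2 * ((a⁻¹ + Real.pi ^ 2 / 48 + 1 / 3) * (((L : ℝ) ^ 2)⁻¹) ^ K)) * a := by
        gcongr
    _ = 2 * a ^ 2 * (a⁻¹ + Real.pi ^ 2 / 48 + 1 / 3) * (((L : ℝ) ^ 2)⁻¹) ^ K := by ring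

/-- ★★★ **LEMMA 4.3 AGAINST THE LIMIT, NONZERO MODES**: for `L` odd `≥ 2`, `a, m² > 0`, `K ≥ 1` and every nonzero momentum `q` of any unit torus,
`|Δ^{(K)}(p′(q)) − Δ^{(∞)}(p′(q))| ≤ (8∕3)·a²(a⁻¹ + π²∕48 + 1∕3)·L^{−2K}` (`L²∕(L²−1) ≤ 4∕3`). [cite: King1986, Lemma 4.3 (4.18) p.672, (4.5) p.670] -/
theorem abs_DeltaEff_sub_lim_le_of_ne_zero (hLodd : Odd L) (hL : 2 ≤ L) {a m2 : ℝ} (ha : 0 < a) (hm : 0 < m2) {K : ℕ} (hK : 1 ≤ K)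
    {q : Tor Mv} (hq : q ≠ 0) :
    |DeltaEff (aK a L K) (L ^ K) m2 (sOf Mv q) - effSymLim a L m2 (sOf Mv q)|
      ≤ 8 / 3 * (a ^ 2 * (a⁻¹ + Real.pi ^ 2 / 48 + 1 / 3)) * ((L : ℝ) ^ (2 * K))⁻¹ := by
  have hL1 : (1 : ℝ) < L := by exact_mod_cast (show 1 < L by omega)
  have hp := abs_sOf_le Mv q
  have hp0 : 0 < momSq (sOf Mv q) := momSq_pos_of_ne_zero (sOf_ne_zero Mv hq)
  set C := 2 * a ^ 2 * (a⁻¹ + Real.pi ^ 2 / 48 + 1 / 3) with hC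
  set r := ((L : ℝ) ^ 2)⁻¹ with hr
  set f : ℕ → ℝ := fun n => DeltaEff (aK a L (n + 1)) (L ^ (n + 1)) m2 (sOf Mv q) with hf
  have hL2r : (2 : ℝ) ≤ L := by exact_mod_cast hL
  have hL2 : 1 < (L : ℝ) ^ 2 := by nlinarith
  have hr1 : r < 1 := inv_lt_one_of_one_lt₀ hL2
  have hr0 : 0 ≤ r := by positivity
  have hC0 : 0 ≤ C := by positivity
  have hstep : ∀ n, dist (f n) (f (n + 1)) ≤ C * r * r ^ n := by
    intro n
    rw [Real.dist_eq]
    have h := abs_DeltaEff_succ_sub_le L hL ha hm (K := n + 1) (by omega) hp hp0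
    calc _ ≤ C * r ^ (n + 1) := h
      _ = C * r * r ^ n := by rw [pow_succ]; ring
  have hlim : Tendsto f atTop (𝓝 (effSymLim a L m2 (sOf Mv q))) :=
    (tendsto_DeltaEff_pow L Mv hLodd hL ha hm q).comp (tendsto_add_atTop_nat 1)
  have hgeo := dist_le_of_le_geometric_of_tendsto r (C * r) hr1 hstep hlim (K - 1)
  have hfK : f (K - 1) = DeltaEff (aK a L K) (L ^ K) m2 (sOf Mv q) := by
    simp only [hf, Nat.sub_add_cancel hK]
  rw [hfK, Real.dist_eq] at hgeo
  have hden : 0 < 1 - r := by linarith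
  have hr4 : r ≤ 4⁻¹ := by
    rw [hr]
    exact inv_anti₀ (by norm_num) (by nlinarith [hL2r])
  have hq' : 1 / (1 - r) ≤ 4 / 3 := by
    rw [div_le_div_iff₀ hden (by norm_num)]
    linarith
  have hrK : r * r ^ (K - 1) = ((L : ℝ) ^ (2 * K))⁻¹ := by
    rw [← pow_succ', Nat.sub_add_cancel hK, hr, ← inv_pow, ← pow_mul, inv_pow]
  calc |DeltaEff (aK a L K) (L ^ K) m2 (sOf Mv q) - effSymLim a L m2 (sOf Mv q)|
      ≤ C * r * r ^ (K - 1) / (1 - r) := hgeo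
    _ = C * ((L : ℝ) ^ (2 * K))⁻¹ * (1 / (1 - r)) := by rw [mul_assoc C, hrK]; ring
    _ ≤ C * ((L : ℝ) ^ (2 * K))⁻¹ * (4 / 3) := mul_le_mul_of_nonneg_left hq' (by positivity)
    _ = 8 / 3 * (a ^ 2 * (a⁻¹ + Real.pi ^ 2 / 48 + 1 / 3)) * ((L : ℝ) ^ (2 * K))⁻¹ := by rw [hC]; ring

end RateNonzero

/-! ## §3 The zero mode's rate and the uniform statement -/

section RateAll

variable (L : ℕ) (Mv : Fin d → ℕ) [hMv : ∀ μ, NeZero (Mv μ)]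

omit hMv in
/-- `0 ≤ a_K − a_∞ ≤ (4∕3)·a·L^{−2K}` (`L ≥ 2`, `K ≥ 1`, `a > 0`): `a_K − a_∞ = a_∞L^{−2K}∕(1 − L^{−2K})`. [cite: King1986, (2.13) p.653] -/
theorem aK_sub_aInf_le (hL : 2 ≤ L) {a : ℝ} (ha : 0 < a) {K : ℕ} (hK : 1 ≤ K) :
    0 ≤ aK a L K - aInf a L ∧ aK a L K - aInf a L ≤ 4 / 3 * a * ((L : ℝ) ^ (2 * K))⁻¹ := by
  have hL1 : (1 : ℝ) < L := by exact_mod_cast (show 1 < L by omega)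
  have hL2r : (2 : ℝ) ≤ L := by exact_mod_cast hL
  refine ⟨by linarith [aInf_le_aK ha hL1 hK], ?_⟩
  have hx1 : ((L : ℝ) ^ (2 * K))⁻¹ ≤ 4⁻¹ := by
    apply inv_anti₀ (by norm_num)
    have h4 : (4 : ℝ) ≤ (L : ℝ) ^ 2 := by nlinarith [hL2r]
    calc (4 : ℝ) ≤ (L : ℝ) ^ 2 := h4
      _ ≤ (L : ℝ) ^ (2 * K) := pow_le_pow_right₀ hL1.le (by omega)
  have hx0 : 0 < ((L : ℝ) ^ (2 * K))⁻¹ := by positivity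
  set x := ((L : ℝ) ^ (2 * K))⁻¹ with hx
  have hden : 0 < 1 - x := by linarith
  have haInf := aInf_pos ha hL1
  have haInfle := aInf_le (L := (L : ℝ)) ha.le
  -- `a_K = a_∞ / (1 − x)`
  have haK : aK a L K = aInf a L / (1 - x) := by
    unfold aK aInf
    rw [hx]
  have e : aK a L K - aInf a L = aInf a L * x / (1 - x) := by
    rw [haK]
    field_simp
    ring
  rw [e, div_le_iff₀ hden]
  have h1 : aInf a L * x ≤ a * x := mul_le_mul_of_nonneg_right haInfle hx0.le
  have h2 : a * x * (3 / 4) ≤ a * x * (1 - x) := mul_le_mul_of_nonneg_left (by linarith) (by positivity)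
  linarith

omit hMv in
/-- The Lipschitz letter: `|(x⁻¹ + c)⁻¹ − (y⁻¹ + c)⁻¹| ≤ |x − y|` for `x, y > 0`, `c ≥ 0`. [cite: King1986, (4.5) p.670, Prop. 3.10 (3.92) p.669] -/
theorem abs_invAddInv_sub_le {x y c : ℝ} (hx : 0 < x) (hy : 0 < y) (hc : 0 ≤ c) : |(x⁻¹ + c)⁻¹ - (y⁻¹ + c)⁻¹| ≤ |x - y| := by
  have hx' : 0 < x⁻¹ + c := by positivity
  have hy' : 0 < y⁻¹ + c := by positivity
  have e : (x⁻¹ + c)⁻¹ - (y⁻¹ + c)⁻¹ = (x - y) / ((1 + c * x) * (1 + c * y)) := by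
    field_simp
    ring
  rw [e, abs_div]
  have hD : 1 ≤ |(1 + c * x) * (1 + c * y)| := by
    rw [abs_of_pos (by positivity)]
    nlinarith [mul_nonneg hc hx.le, mul_nonneg hc hy.le, mul_nonneg (mul_nonneg hc hx.le) (mul_nonneg hc hy.le)]
  exact div_le_self (abs_nonneg _) hD

omit hMv in
/-- ★★ THE ZERO MODE's RATE: `|Δ^{(K)}(0) − Δ^{(∞)}(0)| ≤ (4∕3)·a·L^{−2K}` (`L ≥ 2`, `K ≥ 1`, `a, m² > 0`). [cite: King1986, (4.5) p.670, (2.13) p.653] -/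
theorem abs_DeltaEff_sub_lim_le_zero (hL : 2 ≤ L) {a m2 : ℝ} (ha : 0 < a) (hm : 0 < m2) {K : ℕ} (hK : 1 ≤ K) :
    haveI : NeZero L := ⟨by omega⟩
    |DeltaEff (aK a L K) (L ^ K) m2 (sOf Mv 0) - effSymLim a L m2 (sOf Mv 0)| ≤ 4 / 3 * a * ((L : ℝ) ^ (2 * K))⁻¹ := by
  haveI : NeZero L := ⟨by omega⟩
  have hL1 : (1 : ℝ) < L := by exact_mod_cast (show 1 < L by omega)
  rw [sOf_zero, DeltaEff_zero, effSymLim_zero ha hL1 hm]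
  obtain ⟨_, h2⟩ := aK_sub_aInf_le L hL ha hK
  calc _ ≤ |aK a L K - aInf a L| := abs_invAddInv_sub_le (aK_pos ha hL1 hK) (aInf_pos ha hL1) (by positivity)
    _ ≤ 4 / 3 * a * ((L : ℝ) ^ (2 * K))⁻¹ := by rw [abs_of_nonneg (by linarith [aInf_le_aK ha hL1 hK])]; exact h2

/-- ★★★ **KING's LEMMA 4.3 (4.18) WITH `n = ∞`, UNIFORM**: for `L` odd `≥ 2`, `a, m² > 0`, `K ≥ 1`, every unit torus `Ω` and EVERY momentum `q ∈ Ω̂`,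
`|Δ^{(K)}(p′(q)) − Δ^{(∞)}(p′(q))| ≤ ((8∕3)a²(a⁻¹ + π²∕48 + 1∕3) + (4∕3)a)·L^{−2K}` — one constant depending on `a` only. [cite: King1986, Lemma 4.3 (4.18) p.672, (4.5) p.670] -/
theorem abs_DeltaEff_sub_lim_le (hLodd : Odd L) (hL : 2 ≤ L) {a m2 : ℝ} (ha : 0 < a) (hm : 0 < m2) {K : ℕ} (hK : 1 ≤ K) (q : Tor Mv) :
    |DeltaEff (aK a L K) (L ^ K) m2 (sOf Mv q) - effSymLim a L m2 (sOf Mv q)|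
      ≤ (8 / 3 * (a ^ 2 * (a⁻¹ + Real.pi ^ 2 / 48 + 1 / 3)) + 4 / 3 * a) * ((L : ℝ) ^ (2 * K))⁻¹ := by
  have hx0 : 0 ≤ ((L : ℝ) ^ (2 * K))⁻¹ := by positivity
  have hA : 0 ≤ 8 / 3 * (a ^ 2 * (a⁻¹ + Real.pi ^ 2 / 48 + 1 / 3)) := by positivity
  have hB : 0 ≤ 4 / 3 * a := by positivity
  by_cases hq : q = 0
  · subst hq
    have h := abs_DeltaEff_sub_lim_le_zero L Mv hL ha hm hK
    calc _ ≤ 4 / 3 * a * ((L : ℝ) ^ (2 * K))⁻¹ := h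
      _ ≤ _ := by nlinarith
  · have h := abs_DeltaEff_sub_lim_le_of_ne_zero L Mv hLodd hL ha hm hK hq
    calc _ ≤ 8 / 3 * (a ^ 2 * (a⁻¹ + Real.pi ^ 2 / 48 + 1 / 3)) * ((L : ℝ) ^ (2 * K))⁻¹ := h
      _ ≤ _ := by nlinarith

end RateAll

end Summit.QuantumFields.YangMills.BalabanUVNodes.N15KingModelRung

end
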